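import Literature.NumberTheory.Transcendental.ManyCurveThetaTangent
import Literature.NumberTheory.Transcendental.ManyCurveThetaCosets
import Literature.NumberTheory.Transcendental.PkappaThetaNondeg
import Literature.NumberTheory.Transcendental.PkappaThetaWronskian
import HarnessLib

/-!
# The `k`-lattice theta model: a non-degenerate point and the Wronskian quadratic forms

Topic `Literature/NumberTheory/Transcendental`; unit
`provefact-Literature.NumberTheory.Transcendental.H-0a3eb64689` (fact
`Literature.NumberTheory.Transcendental.HuberWustholzManyCurvePeriods`, `ManyCurvePeriods.lean`).
It introduces NO named fact. Lattice-family counterpart of the two-lattice `TwoCurveThetaWronskian.lean`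
(port of `PkappaThetaNondeg.lean` and of the model-level part of `PkappaThetaWronskian.lean`), for
the theta model of `M = 𝔾ₘ^β × P` with blockwise lattices `Λ_{cls b}` (`ManyCurveTheta.lean`).

## What is proved here (everything; no `sorry`, no new `def … : Prop`)

* `ndPoint` (`w₀ = (0, z₀, 0)` with `z₀_b ∉ Λ_b`, `℘′_{Λ_b}(z₀_b) ≠ 0` blockwise), `ndIdx`, `ndChart`,
  `deriv_ratio_ndIdx`, **`exists_nondeg_point`** — one point where the `n` theta ratios have
  injective differential (field `nondeg` of `AnalyticGroupModel`);
* `aFac`, `lamFac`, `thetaP_eq_decomp` (block decomposition at a block `b`, other blocks with their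
  own lattices), `hasDerivAt_theta_iy/is/iz`, `deriv_theta_line`, `wronskForm` (tables
  `wTabE/R/T` of `Λ_b` in the `z'_b`-direction), `wronsk`, `wronsk_isHomogeneous`,
  `wronskian_iy/is/iz` (block master identity of `Λ_b`), `F_wronsk_of_mem_offDiv` and
  **`F_wronsk`**: `Θ_J ∂_xΘ_I - Θ_I ∂_xΘ_J = Q_{x,I,J}(Θ)` everywhere (fields `wronsk`,
  `isHomogeneous_wronsk`, `F_wronsk`), by density of `offDiv` (`ManyCurveThetaCosets.lean`).

Generic one-lattice material reused: `PeriodPair.exists_derivWeierstrassP_ne_zero`, the tables and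
`PeriodPair.blockMaster`, `kapO`, `deriv_line_eq_sum`, `continuous_deriv_line`, … .

## References

* Yu. V. Nesterenko, P. Philippon (eds.), *Introduction to Algebraic Independence Theory*,
  LNM 1752, Springer 2001, Ch. 11 (D. Roy), §2.2 (i), Lemma 3.1. [NesterenkoPhilippon2001]
* E. T. Whittaker, G. N. Watson, *A Course of Modern Analysis*, 4th ed., CUP 1927, §20.2–20.421.
  [WhittakerWatson1927]
* A. Huber, G. Wüstholz, *Transcendence and Linear Relations of 1-Periods*, CUP 2022, Thm. 15.3.
  [HuberWustholz2022]
-/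

noncomputable section

open Complex Filter Topology MvPolynomial
open scoped PeriodPair ContDiff

namespace Literature.NumberTheory.Transcendental

namespace GaGmEFam

namespace Std

open GaGmE (Kbar)
open GaGmE.Std (iy iz is coords coords_iy coords_iz coords_is ThetaIdx thetaT thetaT_none thetaT_some
  kapO kapO_none kapO_some iz_ne_iz is_ne_iz iy_ne_iz line_single_eq_update thetaT_update_iz deriv_line_eq_sum
  continuous_deriv_line)

variable {𝓙 : Type} [DecidableEq 𝓙] {β γ δ : Type} [Fintype β] [Fintype γ] [Fintype δ] [DecidableEq γ]
variable (L : 𝓙 → PeriodPair) (cls : γ → 𝓙) (κM : δ → γ → Kbar)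

/-! ## A non-degenerate point (port of `PkappaThetaNondeg.lean`) -/

/-! ### The point, the chart and the ratios -/

/-- The point `w₀ = (0, z₀, 0)` (`z₀` blockwise). [folklore] -/
def ndPoint (z₀ : γ → ℂ) : β ⊕ (γ ⊕ δ) → ℂ := fun k =>
  match k with
  | Sum.inr (Sum.inl b) => z₀ b
  | _ => 0

omit [Fintype β] [Fintype γ] [Fintype δ] [DecidableEq γ] in
/-- `y`-coordinates of `w₀`. [folklore] -/
@[simp] theorem ndPoint_iy (z₀ : γ → ℂ) (j : β) : ndPoint (δ := δ) z₀ (iy j) = 0 := rfl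
omit [Fintype β] [Fintype γ] [Fintype δ] [DecidableEq γ] in
/-- `z`-coordinates of `w₀`. [folklore] -/
@[simp] theorem ndPoint_iz (z₀ : γ → ℂ) (b : γ) : ndPoint (β := β) (δ := δ) z₀ (iz b) = z₀ b := rfl
omit [Fintype β] [Fintype γ] [Fintype δ] [DecidableEq γ] in
/-- `s`-coordinates of `w₀`. [folklore] -/
@[simp] theorem ndPoint_is (z₀ : γ → ℂ) (e : δ) : ndPoint (β := β) z₀ (is e) = 0 := rfl

/-- The ratio indices: `iy j ↦ (some j, (0, none))`, `iz b ↦ (none, (0[b ↦ 1], none))`,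
`is e ↦ (none, (0, some e))`. [folklore] -/
def ndIdx : β ⊕ (γ ⊕ δ) → Option β × ThetaIdx γ δ
  | Sum.inl j => (some j, (fun _ => 0, none))
  | Sum.inr (Sum.inl b) => (none, (Function.update (fun _ => 0) b 1, none))
  | Sum.inr (Sum.inr e) => (none, (fun _ => 0, some e))

/-- The chart `J₀ = (none, (0, none))`. [folklore] -/
def ndChart : Option β × ThetaIdx γ δ := (none, (fun _ => 0, none))

omit [Fintype β] [Fintype δ] in
omit [DecidableEq 𝓙] in
/-- `Θ_{J₀}(w) = ∏_b σ(z'_b)³` off the divisors. [folklore] -/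
theorem theta_ndChart {w : β ⊕ (γ ⊕ δ) → ℂ} (hw : ∀ b, w (iz b) ∉ (L (cls b)).lattice) :
    theta L cls κM (ndChart (β := β)) w = ∏ b, (L (cls b)).weierstrassSigma (w (iz b)) ^ 3 := by
  simp only [ndChart, theta, thetaT_none, thetaP_none, one_mul, thetaPnone_eq L cls _ hw]
  simp

omit [Fintype β] [Fintype δ] in
omit [DecidableEq 𝓙] in
/-- `Θ_{(some j,(0,none))}(w) = e^{y'_j} ∏_b σ³`. [folklore] -/
theorem theta_ndIdx_iy {w : β ⊕ (γ ⊕ δ) → ℂ} (hw : ∀ b, w (iz b) ∉ (L (cls b)).lattice) (j : β) :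
    theta L cls κM (ndIdx (Sum.inl j) : Option β × ThetaIdx γ δ) w =
      cexp (w (iy j)) * ∏ b, (L (cls b)).weierstrassSigma (w (iz b)) ^ 3 := by
  simp only [ndIdx, theta, thetaT_some, thetaP_none, thetaPnone_eq L cls _ hw]
  simp

omit [Fintype β] [Fintype δ] in
omit [DecidableEq 𝓙] in
/-- `Θ_{(none,(0[b↦1],none))}(w) = ℘(z'_b) ∏ σ³`. [folklore] -/
theorem theta_ndIdx_iz {w : β ⊕ (γ ⊕ δ) → ℂ} (hw : ∀ b, w (iz b) ∉ (L (cls b)).lattice) (b : γ) :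
    theta L cls κM (ndIdx (β := β) (Sum.inr (Sum.inl b)) : Option β × ThetaIdx γ δ) w =
      ℘[L (cls b)] (w (iz b)) * ∏ b', (L (cls b')).weierstrassSigma (w (iz b')) ^ 3 := by
  classical
  simp only [ndIdx, theta, thetaT_none, thetaP_none, one_mul, thetaPnone_eq L cls _ hw]
  rw [mul_comm]
  congr 1
  rw [← Finset.mul_prod_erase Finset.univ _ (Finset.mem_univ b)]
  rw [Function.update_self]
  have : ∏ x ∈ Finset.univ.erase b, ![1, ℘[L (cls x)] (w (iz x)), ℘'[L (cls x)] (w (iz x))]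
      (Function.update (fun _ => (0 : Fin 3)) b 1 x) = 1 := by
    refine Finset.prod_eq_one fun x hx => ?_
    rw [Function.update_of_ne (Finset.ne_of_mem_erase hx)]
    simp
  rw [this, mul_one]
  simp

omit [Fintype β] [Fintype δ] in
omit [DecidableEq 𝓙] in
/-- `Θ_{(none,(0,some e))}(w) = (s_e - ∑_b κ_{eb} ζ(z'_b)) ∏ σ³`. [folklore] -/
theorem theta_ndIdx_is {w : β ⊕ (γ ⊕ δ) → ℂ} (hw : ∀ b, w (iz b) ∉ (L (cls b)).lattice) (e : δ) :
    theta L cls κM (ndIdx (β := β) (Sum.inr (Sum.inr e)) : Option β × ThetaIdx γ δ) w =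
      (w (is e) - ∑ b, (κM e b : ℂ) * (L (cls b)).weierstrassZeta (w (iz b))) * ∏ b', (L (cls b')).weierstrassSigma (w (iz b')) ^ 3 := by
  simp only [ndIdx, theta, thetaT_none, thetaP_some, one_mul, thetaPsome_eq L cls κM _ e hw]
  simp only [Matrix.cons_val_zero, Finset.prod_const_one, mul_one]
  ring

/-! ### The differential of the ratios -/

omit [Fintype β] [Fintype δ] in
omit [DecidableEq 𝓙] in
/-- **The derivatives of the `n` ratios at `w₀` along `x`.** [folklore] -/
theorem deriv_ratio_ndIdx {z₀ : γ → ℂ} (hz₀ : ∀ b, z₀ b ∉ (L (cls b)).lattice) (x : β ⊕ (γ ⊕ δ) → ℂ)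
    (k : β ⊕ (γ ⊕ δ)) :
    deriv (fun t : ℂ => theta L cls κM (ndIdx k) (ndPoint (β := β) (δ := δ) z₀ + t • x) /
      theta L cls κM (ndChart (β := β)) (ndPoint (β := β) (δ := δ) z₀ + t • x)) 0 =
      match k with
      | Sum.inl j => x (iy j)
      | Sum.inr (Sum.inl b) => ℘'[L (cls b)] (z₀ b) * x (iz b)
      | Sum.inr (Sum.inr e) => x (is e) + ∑ b, (κM e b : ℂ) * (℘[L (cls b)] (z₀ b) * x (iz b)) := by
  -- near `t = 0` all `E`-coordinates stay off the lattice
  have hnear : ∀ᶠ t : ℂ in 𝓝 0, ∀ b, ((ndPoint (β := β) (δ := δ) z₀ + t • x : β ⊕ (γ ⊕ δ) → ℂ) (iz b)) ∉ (L (cls b)).lattice := by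
    have : ∀ b, ∀ᶠ t : ℂ in 𝓝 0, ((ndPoint (β := β) (δ := δ) z₀ + t • x : β ⊕ (γ ⊕ δ) → ℂ) (iz b)) ∉ (L (cls b)).lattice := by
      intro b
      have hc : Continuous fun t : ℂ => ((ndPoint (β := β) (δ := δ) z₀ + t • x : β ⊕ (γ ⊕ δ) → ℂ) (iz b)) := by
        simp only [Pi.add_apply, Pi.smul_apply, smul_eq_mul, ndPoint_iz]; fun_prop
      exact hc.continuousAt.eventually_mem ((L (cls b)).isClosed_lattice.isOpen_compl.mem_nhds (by simpa using hz₀ b))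
    exact Filter.eventually_all.mpr this
  have hσ : ∀ t : ℂ, (∀ b, ((ndPoint (β := β) (δ := δ) z₀ + t • x : β ⊕ (γ ⊕ δ) → ℂ) (iz b)) ∉ (L (cls b)).lattice) →
      ∏ b, (L (cls b)).weierstrassSigma (((ndPoint (β := β) (δ := δ) z₀ + t • x : β ⊕ (γ ⊕ δ) → ℂ) (iz b))) ^ 3 ≠ 0 := fun t ht =>
    Finset.prod_ne_zero_iff.mpr fun b _ => pow_ne_zero _ ((L (cls b)).weierstrassSigma_ne_zero (ht b))
  rcases k with j | b | e
  · -- `e^{t x_j}`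
    have heq : (fun t : ℂ => theta L cls κM (ndIdx (Sum.inl j)) (ndPoint (β := β) (δ := δ) z₀ + t • x) /
        theta L cls κM (ndChart (β := β)) (ndPoint (β := β) (δ := δ) z₀ + t • x)) =ᶠ[𝓝 0] fun t => cexp (t * x (iy j)) := by
      filter_upwards [hnear] with t ht
      rw [theta_ndIdx_iy L cls κM ht, theta_ndChart L cls κM ht, mul_div_assoc, div_self (hσ t ht), mul_one]
      simp
    rw [heq.deriv_eq]
    have h : HasDerivAt (fun t : ℂ => cexp (t * x (iy j))) (cexp (0 * x (iy j)) * (1 * x (iy j))) 0 :=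
      ((hasDerivAt_id (0 : ℂ)).mul_const _).cexp
    rw [h.deriv]; simp
  · -- `℘(z₀ + t x_b)`
    have heq : (fun t : ℂ => theta L cls κM (ndIdx (β := β) (Sum.inr (Sum.inl b))) (ndPoint (β := β) (δ := δ) z₀ + t • x) /
        theta L cls κM (ndChart (β := β)) (ndPoint (β := β) (δ := δ) z₀ + t • x)) =ᶠ[𝓝 0]
        fun t => ℘[L (cls b)] (z₀ b + t * x (iz b)) := by
      filter_upwards [hnear] with t ht
      rw [theta_ndIdx_iz L cls κM ht, theta_ndChart L cls κM ht, mul_div_assoc, div_self (hσ t ht), mul_one]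
      simp
    rw [heq.deriv_eq]
    have h℘ : HasDerivAt ℘[L (cls b)] (℘'[L (cls b)] (z₀ b)) (z₀ b) := by
      have hd : DifferentiableAt ℂ ℘[L (cls b)] (z₀ b) :=
        (L (cls b)).differentiableOn_weierstrassP.differentiableAt
          ((L (cls b)).isClosed_lattice.isOpen_compl.mem_nhds (hz₀ b))
      simpa using hd.hasDerivAt
    have hlin : HasDerivAt (fun t : ℂ => z₀ b + t * x (iz b)) (x (iz b)) 0 := by
      simpa using ((hasDerivAt_id (0 : ℂ)).mul_const (x (iz b))).const_add (z₀ b)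
    have h℘' : HasDerivAt ℘[L (cls b)] (℘'[L (cls b)] (z₀ b)) (z₀ b + 0 * x (iz b)) := by simpa using h℘
    have h : HasDerivAt (fun t : ℂ => ℘[L (cls b)] (z₀ b + t * x (iz b))) (℘'[L (cls b)] (z₀ b) * x (iz b)) 0 := by
      have := h℘'.comp 0 hlin; simpa [Function.comp_def] using this
    rw [h.deriv]
  · -- `t x_e - ∑ κ ζ(z₀ + t x_b)`
    have heq : (fun t : ℂ => theta L cls κM (ndIdx (β := β) (Sum.inr (Sum.inr e))) (ndPoint (β := β) (δ := δ) z₀ + t • x) /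
        theta L cls κM (ndChart (β := β)) (ndPoint (β := β) (δ := δ) z₀ + t • x)) =ᶠ[𝓝 0]
        fun t => t * x (is e) - ∑ b, (κM e b : ℂ) * (L (cls b)).weierstrassZeta (z₀ b + t * x (iz b)) := by
      filter_upwards [hnear] with t ht
      rw [theta_ndIdx_is L cls κM ht, theta_ndChart L cls κM ht, mul_div_assoc, div_self (hσ t ht), mul_one]
      simp
    rw [heq.deriv_eq]
    have hζ : ∀ b, HasDerivAt (fun t : ℂ => (L (cls b)).weierstrassZeta (z₀ b + t * x (iz b)))
        (-℘[L (cls b)] (z₀ b) * x (iz b)) 0 := by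
      intro b
      have hlin : HasDerivAt (fun t : ℂ => z₀ b + t * x (iz b)) (x (iz b)) 0 := by
        simpa using ((hasDerivAt_id (0 : ℂ)).mul_const (x (iz b))).const_add (z₀ b)
      have hζ' : HasDerivAt (L (cls b)).weierstrassZeta (-℘[L (cls b)] (z₀ b)) (z₀ b + 0 * x (iz b)) := by
        simpa using PeriodPair.hasDerivAt_weierstrassZeta (hz₀ b)
      have := hζ'.comp 0 hlin; simpa [Function.comp_def] using this
    have hsum : HasDerivAt (fun t : ℂ => ∑ b, (κM e b : ℂ) * (L (cls b)).weierstrassZeta (z₀ b + t * x (iz b)))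
        (∑ b, (κM e b : ℂ) * (-℘[L (cls b)] (z₀ b) * x (iz b))) 0 :=
      HasDerivAt.fun_sum fun b _ => (hζ b).const_mul (κM e b : ℂ)
    have h1 : HasDerivAt (fun t : ℂ => t * x (is e)) (x (is e)) 0 := by
      simpa using (hasDerivAt_id (0 : ℂ)).mul_const (x (is e))
    have key : HasDerivAt (fun t : ℂ => t * x (is e) - ∑ b, (κM e b : ℂ) * (L (cls b)).weierstrassZeta (z₀ b + t * x (iz b)))
        (x (is e) - ∑ b, (κM e b : ℂ) * (-℘[L (cls b)] (z₀ b) * x (iz b))) 0 := h1.sub hsum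
    rw [key.deriv]
    simp only [mul_neg, neg_mul, Finset.sum_neg_distrib, sub_neg_eq_add]

omit [Fintype β] [Fintype δ] in
omit [DecidableEq 𝓙] in
/-- **One point of `Lie M_κ` where `n` theta ratios have injective differential.**
[cite: NesterenkoPhilippon2001, Ch. 11 §2.2 (i)] -/
theorem exists_nondeg_point :
    ∃ (w₀ : β ⊕ (γ ⊕ δ) → ℂ) (J₀ : Option β × ThetaIdx γ δ) (Js : (β ⊕ (γ ⊕ δ)) → Option β × ThetaIdx γ δ),
      theta L cls κM J₀ w₀ ≠ 0 ∧
      ∀ x : β ⊕ (γ ⊕ δ) → ℂ,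
        (∀ k, deriv (fun t : ℂ => theta L cls κM (Js k) (w₀ + t • x) / theta L cls κM J₀ (w₀ + t • x)) 0 = 0) → x = 0 := by
  have hex := fun b : γ => (L (cls b)).exists_derivWeierstrassP_ne_zero
  choose z₀ hz₀ h℘' using hex
  refine ⟨ndPoint (β := β) (δ := δ) z₀, ndChart, ndIdx, ?_, fun x hx => ?_⟩
  · rw [theta_ndChart L cls κM (fun b => by simpa using hz₀ b)]
    exact Finset.prod_ne_zero_iff.mpr fun b _ => pow_ne_zero _ ((L (cls b)).weierstrassSigma_ne_zero (by simpa using hz₀ b))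
  · have hy : ∀ j, x (iy j) = 0 := fun j => by
      have := hx (Sum.inl j); rwa [deriv_ratio_ndIdx L cls κM hz₀ x] at this
    have hzb : ∀ b, x (iz b) = 0 := fun b => by
      have := hx (Sum.inr (Sum.inl b)); rw [deriv_ratio_ndIdx L cls κM hz₀ x] at this
      exact (mul_eq_zero.mp this).resolve_left (h℘' b)
    have hs : ∀ e, x (is e) = 0 := fun e => by
      have := hx (Sum.inr (Sum.inr e)); rw [deriv_ratio_ndIdx L cls κM hz₀ x] at this
      simpa [hzb] using this
    funext k
    rcases k with j | b | e
    · exact hy j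
    · exact hzb b
    · exact hs e



/-! ## The Wronskian forms (port of `PkappaThetaWronskian.lean`) -/

section Wronskian

variable [DecidableEq β] [DecidableEq δ]

/-! ### The block decomposition of the theta functions of `P_κ` at a block `b` -/

/-- **The other-blocks factor** `a(A, b; w) = ∏_{c ≠ b} P_{A c}(z'_c)`. [folklore] -/
def aFac (A : γ → Fin 3) (b : γ) (w : β ⊕ (γ ⊕ δ) → ℂ) : ℂ :=
  ∏ c ∈ Finset.univ.erase b, (L (cls c)).univExtP (A c) (w (iz c))

/-- **The `Λ`-factor** `Λ(A, o, b; w)`: `a` for `o = none`, and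
`s_e a - ∑_{c≠b} κ_{ec} Z_{A c}(z'_c) ∏_{c'∉{b,c}} P_{A c'}(z'_{c'})` for `o = some e`. [folklore] -/
def lamFac (A : γ → Fin 3) (o : Option δ) (b : γ) (w : β ⊕ (γ ⊕ δ) → ℂ) : ℂ :=
  o.elim (aFac L cls A b w) fun e =>
    w (is e) * aFac L cls A b w -
      ∑ c ∈ Finset.univ.erase b, (κM e c : ℂ) *
        ((L (cls c)).univExtZ (A c) (w (iz c)) * ∏ c' ∈ (Finset.univ.erase b).erase c, (L (cls c')).univExtP (A c') (w (iz c')))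

omit [Fintype β] [Fintype δ] [DecidableEq β] [DecidableEq δ] in
omit [DecidableEq 𝓙] in
/-- `Λ(A, none) = a(A)`. [folklore] -/
@[simp] theorem lamFac_none (A : γ → Fin 3) (b : γ) (w : β ⊕ (γ ⊕ δ) → ℂ) :
    lamFac L cls κM A (none : Option δ) b w = aFac L cls A b w := rfl

omit [Fintype β] [Fintype δ] [DecidableEq β] [DecidableEq δ] in
omit [DecidableEq 𝓙] in
/-- `Λ(A, some e)`. [folklore] -/
theorem lamFac_some (A : γ → Fin 3) (e : δ) (b : γ) (w : β ⊕ (γ ⊕ δ) → ℂ) :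
    lamFac L cls κM A (some e) b w = w (is e) * aFac L cls A b w -
      ∑ c ∈ Finset.univ.erase b, (κM e c : ℂ) *
        ((L (cls c)).univExtZ (A c) (w (iz c)) * ∏ c' ∈ (Finset.univ.erase b).erase c, (L (cls c')).univExtP (A c') (w (iz c'))) := rfl

omit [Fintype β] [Fintype δ] [DecidableEq β] [DecidableEq δ] in
omit [DecidableEq 𝓙] in
/-- **The block decomposition**: `Θ^P_{(A,o)} = P_{A_b}(z'_b) Λ(A,o,b) - κ_{o,b} Z_{A_b}(z'_b) a(A,b)`.
[folklore] -/
theorem thetaP_eq_decomp (A : γ → Fin 3) (o : Option δ) (b : γ) (w : β ⊕ (γ ⊕ δ) → ℂ) :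
    thetaP (β := β) L cls κM (A, o) w =
      (L (cls b)).univExtP (A b) (w (iz b)) * lamFac L cls κM A o b w - kapO κM o b * (L (cls b)).univExtZ (A b) (w (iz b)) * aFac L cls A b w := by
  rcases o with _ | e
  · simp only [thetaP_none, lamFac_none, kapO_none, zero_mul, sub_zero, aFac]
    exact thetaPnone_eq_mul_erase L cls A b w
  · simp only [thetaP_some, lamFac_some, kapO_some]
    unfold thetaPsome
    rw [thetaPnone_eq_mul_erase L cls A b w, ← Finset.add_sum_erase _ _ (Finset.mem_univ b)]
    have hsplit : ∀ c ∈ Finset.univ.erase b,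
        (κM e c : ℂ) * ((L (cls c)).univExtZ (A c) (w (iz c)) * ∏ b' ∈ Finset.univ.erase c, (L (cls b')).univExtP (A b') (w (iz b'))) =
        (L (cls b)).univExtP (A b) (w (iz b)) * ((κM e c : ℂ) *
          ((L (cls c)).univExtZ (A c) (w (iz c)) * ∏ c' ∈ (Finset.univ.erase b).erase c, (L (cls c')).univExtP (A c') (w (iz c')))) := by
      intro c hc
      have hbc : b ∈ Finset.univ.erase c := Finset.mem_erase.mpr ⟨(Finset.ne_of_mem_erase hc).symm, Finset.mem_univ b⟩
      rw [← Finset.mul_prod_erase _ _ hbc, Finset.erase_right_comm]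
      ring
    rw [Finset.sum_congr rfl hsplit, ← Finset.mul_sum]
    unfold aFac
    ring

omit [Fintype β] [Fintype δ] [DecidableEq β] [DecidableEq δ] in
omit [DecidableEq 𝓙] in
/-- `a` does not see the modified block. [folklore] -/
theorem aFac_update_idx (A : γ → Fin 3) (b : γ) (l : Fin 3) (w : β ⊕ (γ ⊕ δ) → ℂ) :
    aFac L cls (Function.update A b l) b w = aFac L cls A b w := by
  unfold aFac
  exact Finset.prod_congr rfl fun c hc => by rw [Function.update_of_ne (Finset.ne_of_mem_erase hc)]

omit [Fintype β] [Fintype δ] [DecidableEq β] [DecidableEq δ] in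
omit [DecidableEq 𝓙] in
/-- `Λ` does not see the modified block. [folklore] -/
theorem lamFac_update_idx (A : γ → Fin 3) (o : Option δ) (b : γ) (l : Fin 3) (w : β ⊕ (γ ⊕ δ) → ℂ) :
    lamFac L cls κM (Function.update A b l) o b w = lamFac L cls κM A o b w := by
  rcases o with _ | e
  · simp only [lamFac_none, aFac_update_idx]
  · simp only [lamFac_some, aFac_update_idx]
    congr 1
    refine Finset.sum_congr rfl fun c hc => ?_
    rw [Function.update_of_ne (Finset.ne_of_mem_erase hc)]
    congr 2
    exact Finset.prod_congr rfl fun c' hc' => by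
      rw [Function.update_of_ne (Finset.ne_of_mem_erase (Finset.mem_of_mem_erase hc'))]

omit [Fintype β] [Fintype δ] in
omit [DecidableEq 𝓙] in
/-- `a` does not see the `b`-coordinate of the point. [folklore] -/
theorem aFac_update_pt (A : γ → Fin 3) (b : γ) (w : β ⊕ (γ ⊕ δ) → ℂ) (v : ℂ) :
    aFac L cls A b (Function.update w (iz b) v) = aFac L cls A b w := by
  unfold aFac
  exact Finset.prod_congr rfl fun c hc => by rw [Function.update_of_ne (iz_ne_iz (Finset.ne_of_mem_erase hc))]

omit [Fintype β] [Fintype δ] in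
omit [DecidableEq 𝓙] in
/-- `Λ` does not see the `b`-coordinate of the point. [folklore] -/
theorem lamFac_update_pt (A : γ → Fin 3) (o : Option δ) (b : γ) (w : β ⊕ (γ ⊕ δ) → ℂ) (v : ℂ) :
    lamFac L cls κM A o b (Function.update w (iz b) v) = lamFac L cls κM A o b w := by
  rcases o with _ | e
  · simp only [lamFac_none, aFac_update_pt]
  · simp only [lamFac_some, aFac_update_pt, Function.update_of_ne (is_ne_iz (β := β) e b)]
    congr 1
    refine Finset.sum_congr rfl fun c hc => ?_
    rw [Function.update_of_ne (iz_ne_iz (Finset.ne_of_mem_erase hc))]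
    congr 2
    exact Finset.prod_congr rfl fun c' hc' => by
      rw [Function.update_of_ne (iz_ne_iz (Finset.ne_of_mem_erase (Finset.mem_of_mem_erase hc')))]

omit [Fintype β] [Fintype δ] in
omit [DecidableEq 𝓙] in
/-- **The modified theta function at a moved point**:
`Θ^P_{(A[b↦l],o)}(w[z'_b ↦ v]) = P_l(v) Λ(A,o,b;w) - κ_{o,b} Z_l(v) a(A,b;w)`. [folklore] -/
theorem thetaP_update_update (A : γ → Fin 3) (o : Option δ) (b : γ) (l : Fin 3) (w : β ⊕ (γ ⊕ δ) → ℂ) (v : ℂ) :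
    thetaP (β := β) L cls κM (Function.update A b l, o) (Function.update w (iz b) v) =
      (L (cls b)).univExtP l v * lamFac L cls κM A o b w - kapO κM o b * (L (cls b)).univExtZ l v * aFac L cls A b w := by
  rw [thetaP_eq_decomp L cls κM _ o b, Function.update_self, Function.update_self, lamFac_update_pt, aFac_update_pt,
    lamFac_update_idx, aFac_update_idx]

omit [Fintype β] [Fintype δ] in
omit [DecidableEq 𝓙] in
/-- The modified theta function at the point itself. [folklore] -/
theorem thetaP_update_eq (A : γ → Fin 3) (o : Option δ) (b : γ) (l : Fin 3) (w : β ⊕ (γ ⊕ δ) → ℂ) :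
    thetaP (β := β) L cls κM (Function.update A b l, o) w =
      (L (cls b)).univExtP l (w (iz b)) * lamFac L cls κM A o b w - kapO κM o b * (L (cls b)).univExtZ l (w (iz b)) * aFac L cls A b w := by
  have h := thetaP_update_update L cls κM A o b l w (w (iz b))
  rwa [Function.update_eq_self] at h

/-! ### Lines along the coordinate directions -/

omit [Fintype β] [Fintype δ] in
omit [DecidableEq 𝓙] in
/-- **The derivative of a theta function of `P_κ` along `z'_b`**:
`d/dt Θ^P_{(A,o)}(w + t e_{z_b})|₀ = P′_{A_b}(z'_b) Λ - κ_{o,b} Z′_{A_b}(z'_b) a`. [folklore] -/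
theorem hasDerivAt_thetaP_iz (A : γ → Fin 3) (o : Option δ) (b : γ)
    (w : β ⊕ (γ ⊕ δ) → ℂ) :
    HasDerivAt (fun t : ℂ => thetaP (β := β) L cls κM (A, o) (w + t • (Pi.single (iz b) (1 : ℂ) : β ⊕ (γ ⊕ δ) → ℂ)))
      ((L (cls b)).univExtP' (A b) (w (iz b)) * lamFac L cls κM A o b w -
        kapO κM o b * (L (cls b)).univExtZ' (A b) (w (iz b)) * aFac L cls A b w) 0 := by
  have hfun : (fun t : ℂ => thetaP (β := β) L cls κM (A, o) (w + t • (Pi.single (iz b) (1 : ℂ) : β ⊕ (γ ⊕ δ) → ℂ))) =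
      fun t => (L (cls b)).univExtP (A b) (w (iz b) + t) * lamFac L cls κM A o b w -
        kapO κM o b * (L (cls b)).univExtZ (A b) (w (iz b) + t) * aFac L cls A b w := by
    funext t
    rw [line_single_eq_update]
    have h := thetaP_update_update L cls κM A o b (A b) w (w (iz b) + t)
    rwa [Function.update_eq_self] at h
  rw [hfun]
  have hg : HasDerivAt (fun t : ℂ => w (iz b) + t) 1 0 := by simpa using (hasDerivAt_id (0 : ℂ)).const_add (w (iz b))
  have hP : HasDerivAt (fun t : ℂ => (L (cls b)).univExtP (A b) (w (iz b) + t)) ((L (cls b)).univExtP' (A b) (w (iz b))) 0 := by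
    have h := ((L (cls b)).hasDerivAt_univExtP (A b) (w (iz b) + 0)).comp 0 hg
    simpa [Function.comp_def] using h
  have hZ : HasDerivAt (fun t : ℂ => (L (cls b)).univExtZ (A b) (w (iz b) + t)) ((L (cls b)).univExtZ' (A b) (w (iz b))) 0 := by
    have h := ((L (cls b)).hasDerivAt_univExtZ (A b) (w (iz b) + 0)).comp 0 hg
    simpa [Function.comp_def] using h
  exact (hP.mul_const _).sub ((hZ.const_mul _).mul_const _)

/-! ### Derivatives of the theta functions of `M_κ` along the coordinate directions -/

omit [Fintype β] [Fintype δ] in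
omit [DecidableEq 𝓙] in
/-- The theta functions of `P_κ` do not see the torus coordinates. [folklore] -/
theorem thetaP_update_iy (I : ThetaIdx γ δ) (w : β ⊕ (γ ⊕ δ) → ℂ) (j : β) (v : ℂ) :
    thetaP (β := β) L cls κM I (Function.update w (iy j) v) = thetaP L cls κM I w := by
  have hz : ∀ c : γ, Function.update w (iy j) v (iz c) = w (iz c) := fun c =>
    Function.update_of_ne (by simp [iy, iz]) _ _
  obtain ⟨A, _ | e⟩ := I
  · simp only [thetaP_none, thetaPnone, hz]
  · have hs : Function.update w (iy j) v (is e) = w (is e) := Function.update_of_ne (by simp [iy, is]) _ _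
    simp only [thetaP_some, thetaPsome, thetaPnone, hz, hs]

omit [Fintype β] [Fintype δ] in
omit [DecidableEq 𝓙] in
/-- **Along a torus coordinate**: `d/dt Θ_{(a,I)}(w + t e_{y_j})|₀ = [a = j] Θ_{(a,I)}(w)`. [folklore] -/
theorem hasDerivAt_theta_iy (a : Option β) (I : ThetaIdx γ δ) (w : β ⊕ (γ ⊕ δ) → ℂ) (j : β) :
    HasDerivAt (fun t : ℂ => theta L cls κM (a, I) (w + t • (Pi.single (iy j) (1 : ℂ) : β ⊕ (γ ⊕ δ) → ℂ)))
      ((if a = some j then 1 else 0) * theta L cls κM (a, I) w) 0 := by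
  simp only [line_single_eq_update, theta, thetaP_update_iy]
  rcases a with _ | j'
  · simp only [thetaT_none, one_mul, reduceCtorEq, if_false, zero_mul]
    exact hasDerivAt_const _ _
  · by_cases hj : j' = j
    · subst hj
      simp only [thetaT_some, Function.update_self, if_true, one_mul]
      have h : HasDerivAt (fun t : ℂ => cexp (w (iy j') + t)) (cexp (w (iy j'))) 0 := by
        simpa using ((hasDerivAt_id (0 : ℂ)).const_add (w (iy j'))).cexp
      exact h.mul_const _
    · have hne : (iy j' : β ⊕ (γ ⊕ δ)) ≠ iy j := by simpa [iy] using hj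
      simp only [thetaT_some, Function.update_of_ne hne, Option.some.injEq, hj, if_false, zero_mul]
      exact hasDerivAt_const _ _

omit [Fintype β] [Fintype δ] in
omit [DecidableEq 𝓙] in
/-- **Along a fibre coordinate**: `d/dt Θ_{(a,(A,o))}(w + t e_{s_e})|₀ = [o = e] Θ_{(a,(A,∅))}(w)`. [folklore] -/
theorem hasDerivAt_theta_is (a : Option β) (A : γ → Fin 3) (o : Option δ) (w : β ⊕ (γ ⊕ δ) → ℂ) (e : δ) :
    HasDerivAt (fun t : ℂ => theta L cls κM (a, (A, o)) (w + t • (Pi.single (is e) (1 : ℂ) : β ⊕ (γ ⊕ δ) → ℂ)))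
      ((if o = some e then 1 else 0) * theta L cls κM (a, (A, none)) w) 0 := by
  have hz : ∀ (v : ℂ) (c : γ), Function.update w (is e) v (iz c) = w (iz c) := fun v c =>
    Function.update_of_ne (by simp [is, iz]) _ _
  have hy : ∀ v : ℂ, thetaT (γ := γ) (δ := δ) a (Function.update w (is e) v) = thetaT a w := by
    intro v
    rcases a with _ | j
    · rfl
    · simp only [thetaT_some, Function.update_of_ne (show (iy j : β ⊕ (γ ⊕ δ)) ≠ is e by simp [iy, is])]
  simp only [line_single_eq_update, theta, hy, thetaP_none]
  rcases o with _ | e'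
  · simp only [thetaP_none, thetaPnone, hz, reduceCtorEq, if_false, zero_mul]
    exact hasDerivAt_const _ _
  · simp only [thetaP_some, thetaPsome, thetaPnone, hz, Option.some.injEq]
    by_cases he : e' = e
    · subst he
      simp only [Function.update_self, if_true, one_mul]
      have h1 : HasDerivAt (fun t : ℂ => w (is e') + t) 1 0 := by simpa using (hasDerivAt_id (0 : ℂ)).const_add (w (is e'))
      have h2 := ((h1.mul_const (∏ b, (L (cls b)).univExtP (A b) (w (iz b)))).sub_const
        (∑ b, (κM e' b : ℂ) * ((L (cls b)).univExtZ (A b) (w (iz b)) * ∏ b' ∈ Finset.univ.erase b, (L (cls b')).univExtP (A b') (w (iz b'))))).const_mul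
        (thetaT (γ := γ) (δ := δ) a w)
      simpa using h2
    · have hne : (is e' : β ⊕ (γ ⊕ δ)) ≠ is e := by simpa [is] using he
      simp only [Function.update_of_ne hne, he, if_false, zero_mul]
      exact hasDerivAt_const _ _

omit [Fintype β] [Fintype δ] in
omit [DecidableEq 𝓙] in
/-- **Along an `E`-coordinate**: `d/dt Θ_{(a,(A,o))}(w + t e_{z_b})|₀ = T_a (P′_{A_b} Λ - κ_{o,b} Z′_{A_b} a)`. [folklore] -/
theorem hasDerivAt_theta_iz (a : Option β) (A : γ → Fin 3) (o : Option δ) (b : γ) (w : β ⊕ (γ ⊕ δ) → ℂ) :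
    HasDerivAt (fun t : ℂ => theta L cls κM (a, (A, o)) (w + t • (Pi.single (iz b) (1 : ℂ) : β ⊕ (γ ⊕ δ) → ℂ)))
      (thetaT (γ := γ) (δ := δ) a w * ((L (cls b)).univExtP' (A b) (w (iz b)) * lamFac L cls κM A o b w -
        kapO κM o b * (L (cls b)).univExtZ' (A b) (w (iz b)) * aFac L cls A b w)) 0 := by
  have hT : ∀ t : ℂ, thetaT (γ := γ) (δ := δ) a (w + t • (Pi.single (iz b) (1 : ℂ) : β ⊕ (γ ⊕ δ) → ℂ)) = thetaT a w := by
    intro t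
    rw [line_single_eq_update, thetaT_update_iz]
  simp only [theta, hT]
  exact (hasDerivAt_thetaP_iz L cls κM A o b w).const_mul _

/-! ### The derivative along a general direction -/

omit [DecidableEq 𝓙] in
/-- The derivative of `Θ_J` along `x`, decomposed. [folklore] -/
theorem deriv_theta_line (J : Option β × ThetaIdx γ δ) (w x : β ⊕ (γ ⊕ δ) → ℂ) :
    deriv (fun t : ℂ => theta L cls κM J (w + t • x)) 0 =
      ∑ k, x k * deriv (fun t : ℂ => theta L cls κM J (w + t • (Pi.single k (1 : ℂ) : β ⊕ (γ ⊕ δ) → ℂ))) 0 :=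
  deriv_line_eq_sum (differentiable_theta L cls κM J) w x

/-! ### The quadratic forms -/

/-- **The Wronskian forms along the coordinate directions.** Along `y_j`:
`([a=j] - [a'=j]) X_I X_J`; along `s_e`: `[o=e] X_J X_{(a,(A,∅))} - [o'=e] X_I X_{(a',(B,∅))}`; along
`z'_b`: the form of the block master identity with the tables `ω, r, t`. [folklore] -/
def wronskForm : (β ⊕ (γ ⊕ δ)) → Option β × ThetaIdx γ δ → Option β × ThetaIdx γ δ →
    MvPolynomial (Option β × ThetaIdx γ δ) ℂ
  | Sum.inl j, (a, I), (a', J) =>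
      C ((if a = some j then 1 else 0) - (if a' = some j then 1 else 0)) * (X (a, I) * X (a', J))
  | Sum.inr (Sum.inr e), (a, (A, o)), (a', (B, o')) =>
      C (if o = some e then 1 else 0) * (X (a', (B, o')) * X (a, (A, none))) -
        C (if o' = some e then 1 else 0) * (X (a, (A, o)) * X (a', (B, none)))
  | Sum.inr (Sum.inl b), (a, (A, o)), (a', (B, o')) =>
      ∑ l : Fin 3, ∑ m : Fin 3,
        (C ((L (cls b)).wTabE (A b) (B b) l m) * (X (a, (Function.update A b l, o)) * X (a', (Function.update B b m, o'))) +
          C (kapO κM o b * (L (cls b)).wTabR (A b) (B b) l m) *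
            (X (a, (Function.update A b l, none)) * X (a', (Function.update B b m, o'))) -
          C (kapO κM o' b * (L (cls b)).wTabR (B b) (A b) l m) *
            (X (a, (Function.update A b m, o)) * X (a', (Function.update B b l, none))) +
          C (kapO κM o b * kapO κM o' b * (L (cls b)).wTabT (A b) (B b) l m) *
            (X (a, (Function.update A b l, none)) * X (a', (Function.update B b m, none))))

/-- **The Wronskian form along `x`**: `Q_{x,I,J} = ∑_k x_k Q_{k,I,J}`. [cite: NesterenkoPhilippon2001, Ch. 11 Lemma 3.1] -/
def wronsk (x : β ⊕ (γ ⊕ δ) → ℂ) (I J : Option β × ThetaIdx γ δ) : MvPolynomial (Option β × ThetaIdx γ δ) ℂ :=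
  ∑ k, C (x k) * wronskForm L cls κM k I J

omit [Fintype β] [Fintype γ] [Fintype δ] in
omit [DecidableEq 𝓙] in
/-- The coordinate Wronskian forms are quadratic. [folklore] -/
theorem wronskForm_isHomogeneous (k : β ⊕ (γ ⊕ δ)) (I J : Option β × ThetaIdx γ δ) :
    (wronskForm L cls κM k I J).IsHomogeneous 2 := by
  have hXX : ∀ (P Q : Option β × ThetaIdx γ δ) (c : ℂ),
      (C c * (X P * X Q) : MvPolynomial (Option β × ThetaIdx γ δ) ℂ).IsHomogeneous 2 := by
    intro P Q c
    simpa using ((isHomogeneous_X ℂ P).mul (isHomogeneous_X ℂ Q)).C_mul c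
  obtain ⟨a, A, o⟩ := I
  obtain ⟨a', B, o'⟩ := J
  rcases k with j | b | e
  · exact hXX _ _ _
  · exact IsHomogeneous.sum _ _ _ fun l _ => IsHomogeneous.sum _ _ _ fun m _ =>
      (((hXX _ _ _).add (hXX _ _ _)).sub (hXX _ _ _)).add (hXX _ _ _)
  · exact (hXX _ _ _).sub (hXX _ _ _)

omit [DecidableEq 𝓙] in
/-- **The Wronskian forms are quadratic** (field `isHomogeneous_wronsk`). [folklore] -/
theorem wronsk_isHomogeneous (x : β ⊕ (γ ⊕ δ) → ℂ) (I J : Option β × ThetaIdx γ δ) :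
    (wronsk L cls κM x I J).IsHomogeneous 2 := by
  unfold wronsk
  refine IsHomogeneous.sum _ _ _ fun k _ => ?_
  simpa using (wronskForm_isHomogeneous L cls κM k I J).C_mul (x k)

/-! ### The Wronskians along the coordinate directions -/

omit [Fintype β] [Fintype δ] in
omit [DecidableEq 𝓙] in
/-- Along `y_j`. [folklore] -/
theorem wronskian_iy (I J : Option β × ThetaIdx γ δ) (w : β ⊕ (γ ⊕ δ) → ℂ) (j : β) :
    theta L cls κM J w * deriv (fun t : ℂ => theta L cls κM I (w + t • (Pi.single (iy j) (1 : ℂ) : β ⊕ (γ ⊕ δ) → ℂ))) 0 -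
        theta L cls κM I w * deriv (fun t : ℂ => theta L cls κM J (w + t • (Pi.single (iy j) (1 : ℂ) : β ⊕ (γ ⊕ δ) → ℂ))) 0 =
      thetaEval L cls κM (wronskForm L cls κM (iy j) I J) w := by
  obtain ⟨a, I'⟩ := I
  obtain ⟨a', J'⟩ := J
  rw [(hasDerivAt_theta_iy L cls κM a I' w j).deriv, (hasDerivAt_theta_iy L cls κM a' J' w j).deriv]
  simp only [iy, wronskForm, thetaEval, map_mul, map_sub, eval_C, eval_X]
  ring

omit [Fintype β] [Fintype δ] in
omit [DecidableEq 𝓙] in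
/-- Along `s_e`. [folklore] -/
theorem wronskian_is (I J : Option β × ThetaIdx γ δ) (w : β ⊕ (γ ⊕ δ) → ℂ) (e : δ) :
    theta L cls κM J w * deriv (fun t : ℂ => theta L cls κM I (w + t • (Pi.single (is e) (1 : ℂ) : β ⊕ (γ ⊕ δ) → ℂ))) 0 -
        theta L cls κM I w * deriv (fun t : ℂ => theta L cls κM J (w + t • (Pi.single (is e) (1 : ℂ) : β ⊕ (γ ⊕ δ) → ℂ))) 0 =
      thetaEval L cls κM (wronskForm L cls κM (is e) I J) w := by
  obtain ⟨a, A, o⟩ := I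
  obtain ⟨a', B, o'⟩ := J
  rw [(hasDerivAt_theta_is L cls κM a A o w e).deriv, (hasDerivAt_theta_is L cls κM a' B o' w e).deriv]
  simp only [is, wronskForm, thetaEval, map_mul, map_sub, eval_C, eval_X]
  ring

omit [Fintype β] [Fintype δ] in
omit [DecidableEq 𝓙] in
/-- The value of the `z'_b`-form: the right-hand side of the block master identity times `T_a T_{a'}`.
[folklore] -/
theorem thetaEval_wronskForm_iz (a a' : Option β) (A B : γ → Fin 3) (o o' : Option δ) (b : γ) (w : β ⊕ (γ ⊕ δ) → ℂ) :
    thetaEval L cls κM (wronskForm L cls κM (iz b) (a, (A, o)) (a', (B, o'))) w =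
      thetaT (γ := γ) (δ := δ) a w * thetaT (γ := γ) (δ := δ) a' w *
        ∑ l : Fin 3, ∑ m : Fin 3,
          ((L (cls b)).wTabE (A b) (B b) l m *
              (((L (cls b)).univExtP l (w (iz b)) * lamFac L cls κM A o b w - kapO κM o b * (L (cls b)).univExtZ l (w (iz b)) * aFac L cls A b w) *
                ((L (cls b)).univExtP m (w (iz b)) * lamFac L cls κM B o' b w - kapO κM o' b * (L (cls b)).univExtZ m (w (iz b)) * aFac L cls B b w)) +
            kapO κM o b * (L (cls b)).wTabR (A b) (B b) l m *
              (((L (cls b)).univExtP l (w (iz b)) * aFac L cls A b w) *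
                ((L (cls b)).univExtP m (w (iz b)) * lamFac L cls κM B o' b w - kapO κM o' b * (L (cls b)).univExtZ m (w (iz b)) * aFac L cls B b w)) -
            kapO κM o' b * (L (cls b)).wTabR (B b) (A b) l m *
              (((L (cls b)).univExtP m (w (iz b)) * lamFac L cls κM A o b w - kapO κM o b * (L (cls b)).univExtZ m (w (iz b)) * aFac L cls A b w) *
                ((L (cls b)).univExtP l (w (iz b)) * aFac L cls B b w)) +
            kapO κM o b * kapO κM o' b * (L (cls b)).wTabT (A b) (B b) l m *
              (((L (cls b)).univExtP l (w (iz b)) * aFac L cls A b w) * ((L (cls b)).univExtP m (w (iz b)) * aFac L cls B b w))) := by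
  have hθ : ∀ (a₁ : Option β) (N : γ → Fin 3) (o₁ : Option δ) (l : Fin 3),
      theta L cls κM (a₁, (Function.update N b l, o₁)) w =
        thetaT (γ := γ) (δ := δ) a₁ w * ((L (cls b)).univExtP l (w (iz b)) * lamFac L cls κM N o₁ b w -
          kapO κM o₁ b * (L (cls b)).univExtZ l (w (iz b)) * aFac L cls N b w) := by
    intro a₁ N o₁ l
    rw [theta, thetaP_update_eq]
  have hθ0 : ∀ (a₁ : Option β) (N : γ → Fin 3) (l : Fin 3),
      theta L cls κM (a₁, (Function.update N b l, none)) w =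
        thetaT (γ := γ) (δ := δ) a₁ w * ((L (cls b)).univExtP l (w (iz b)) * aFac L cls N b w) := by
    intro a₁ N l
    rw [hθ, kapO_none, lamFac_none]
    ring
  simp only [iz, wronskForm, thetaEval, map_sum, map_add, map_sub, map_mul, eval_C, eval_X]
  simp only [show (Sum.inr (Sum.inl b) : β ⊕ (γ ⊕ δ)) = iz b from rfl] at *
  rw [Finset.mul_sum]
  refine Finset.sum_congr rfl fun l _ => ?_
  rw [Finset.mul_sum]
  refine Finset.sum_congr rfl fun m _ => ?_
  rw [hθ a A o l, hθ a' B o' m, hθ0 a A l, hθ0 a' B l, hθ a A o m, hθ0 a' B m]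
  ring

omit [Fintype β] [Fintype δ] in
omit [DecidableEq 𝓙] in
/-- **Along `z'_b`** (off the divisor `z'_b ∈ Λ`): the block master identity. [folklore] -/
theorem wronskian_iz (I J : Option β × ThetaIdx γ δ) {w : β ⊕ (γ ⊕ δ) → ℂ} (b : γ) (hw : w (iz b) ∉ (L (cls b)).lattice) :
    theta L cls κM J w * deriv (fun t : ℂ => theta L cls κM I (w + t • (Pi.single (iz b) (1 : ℂ) : β ⊕ (γ ⊕ δ) → ℂ))) 0 -
        theta L cls κM I w * deriv (fun t : ℂ => theta L cls κM J (w + t • (Pi.single (iz b) (1 : ℂ) : β ⊕ (γ ⊕ δ) → ℂ))) 0 =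
      thetaEval L cls κM (wronskForm L cls κM (iz b) I J) w := by
  obtain ⟨a, A, o⟩ := I
  obtain ⟨a', B, o'⟩ := J
  rw [(hasDerivAt_theta_iz L cls κM a A o b w).deriv, (hasDerivAt_theta_iz L cls κM a' B o' b w).deriv,
    thetaEval_wronskForm_iz, ← (L (cls b)).blockMaster (A b) (B b) hw]
  have hI : theta L cls κM (a, (A, o)) w = thetaT (γ := γ) (δ := δ) a w *
      ((L (cls b)).univExtP (A b) (w (iz b)) * lamFac L cls κM A o b w - kapO κM o b * (L (cls b)).univExtZ (A b) (w (iz b)) * aFac L cls A b w) := by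
    rw [theta, thetaP_eq_decomp L cls κM A o b]
  have hJ : theta L cls κM (a', (B, o')) w = thetaT (γ := γ) (δ := δ) a' w *
      ((L (cls b)).univExtP (B b) (w (iz b)) * lamFac L cls κM B o' b w - kapO κM o' b * (L (cls b)).univExtZ (B b) (w (iz b)) * aFac L cls B b w) := by
    rw [theta, thetaP_eq_decomp L cls κM B o' b]
  rw [hI, hJ]
  ring

/-! ### The main theorem -/

omit [DecidableEq 𝓙] in
/-- **The Wronskians on the dense set `offDiv`.** [folklore] -/
theorem F_wronsk_of_mem_offDiv (x : β ⊕ (γ ⊕ δ) → ℂ) (I J : Option β × ThetaIdx γ δ) {w : β ⊕ (γ ⊕ δ) → ℂ}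
    (hw : w ∈ offDiv β δ L cls (γ := γ)) :
    theta L cls κM J w * deriv (fun t : ℂ => theta L cls κM I (w + t • x)) 0 -
        theta L cls κM I w * deriv (fun t : ℂ => theta L cls κM J (w + t • x)) 0 =
      thetaEval L cls κM (wronsk L cls κM x I J) w := by
  rw [deriv_theta_line L cls κM I w x, deriv_theta_line L cls κM J w x, Finset.mul_sum, Finset.mul_sum, ← Finset.sum_sub_distrib]
  unfold wronsk
  rw [thetaEval, map_sum]
  refine Finset.sum_congr rfl fun k _ => ?_
  rw [map_mul, eval_C, ← thetaEval]
  have hk : theta L cls κM J w * deriv (fun t : ℂ => theta L cls κM I (w + t • (Pi.single k (1 : ℂ) : β ⊕ (γ ⊕ δ) → ℂ))) 0 -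
      theta L cls κM I w * deriv (fun t : ℂ => theta L cls κM J (w + t • (Pi.single k (1 : ℂ) : β ⊕ (γ ⊕ δ) → ℂ))) 0 =
      thetaEval L cls κM (wronskForm L cls κM k I J) w := by
    rcases k with j | b | e
    · exact wronskian_iy L cls κM I J w j
    · exact wronskian_iz L cls κM I J b (hw b)
    · exact wronskian_is L cls κM I J w e
  rw [← hk]
  ring

omit [DecidableEq 𝓙] in
/-- **The Wronskians of the theta model are quadratic forms (field `F_wronsk` of `AnalyticGroupModel`)**:
for every direction `x` and all `I, J`,
`Θ_J(w) ∂_xΘ_I(w) - Θ_I(w) ∂_xΘ_J(w) = Q_{x,I,J}(Θ(w))` at every `w ∈ Lie M_κ,ℂ`.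
[cite: NesterenkoPhilippon2001, Ch. 11 Lemma 3.1] -/
theorem F_wronsk (x : β ⊕ (γ ⊕ δ) → ℂ) (I J : Option β × ThetaIdx γ δ) (w : β ⊕ (γ ⊕ δ) → ℂ) :
    theta L cls κM J w * deriv (fun t : ℂ => theta L cls κM I (w + t • x)) 0 -
        theta L cls κM I w * deriv (fun t : ℂ => theta L cls κM J (w + t • x)) 0 =
      thetaEval L cls κM (wronsk L cls κM x I J) w := by
  -- both sides are continuous in `w` and agree on the dense set `offDiv`
  have hθc : ∀ K : Option β × ThetaIdx γ δ, ContDiff ℂ ω (theta L cls κM K) := fun K => by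
    have h := contDiff_thetaEval L cls κM (X K)
    have hfun : thetaEval L cls κM (X K) = theta L cls κM K := funext fun w => by simp [thetaEval]
    rwa [hfun] at h
  have hL : Continuous fun w => theta L cls κM J w * deriv (fun t : ℂ => theta L cls κM I (w + t • x)) 0 -
      theta L cls κM I w * deriv (fun t : ℂ => theta L cls κM J (w + t • x)) 0 :=
    ((differentiable_theta L cls κM J).continuous.mul (continuous_deriv_line (hθc I) x)).sub
      ((differentiable_theta L cls κM I).continuous.mul (continuous_deriv_line (hθc J) x))
  have hR : Continuous fun w => thetaEval L cls κM (wronsk L cls κM x I J) w := (contDiff_thetaEval L cls κM _).continuous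
  have hclosed : IsClosed {w : β ⊕ (γ ⊕ δ) → ℂ | theta L cls κM J w * deriv (fun t : ℂ => theta L cls κM I (w + t • x)) 0 -
      theta L cls κM I w * deriv (fun t : ℂ => theta L cls κM J (w + t • x)) 0 = thetaEval L cls κM (wronsk L cls κM x I J) w} :=
    isClosed_eq hL hR
  have hdense : Dense {w : β ⊕ (γ ⊕ δ) → ℂ | theta L cls κM J w * deriv (fun t : ℂ => theta L cls κM I (w + t • x)) 0 -
      theta L cls κM I w * deriv (fun t : ℂ => theta L cls κM J (w + t • x)) 0 = thetaEval L cls κM (wronsk L cls κM x I J) w} :=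
    (dense_offDiv L cls).mono fun w hw => F_wronsk_of_mem_offDiv L cls κM x I J hw
  have huniv := hdense.closure_eq
  rw [hclosed.closure_eq] at huniv
  have hmem : w ∈ (Set.univ : Set (β ⊕ (γ ⊕ δ) → ℂ)) := Set.mem_univ w
  rw [← huniv] at hmem
  exact hmem



end Wronskian

end Std

end GaGmEFam

end Literature.NumberTheory.Transcendental

end
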